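import Literature.NumberTheory.EllipticCurves.SelmerRestrictionCorank
import Literature.NumberTheory.EllipticCurves.SelmerGroupOverTorsionFinite
import HarnessLib

/-!
# `rk_p(E/F') = corank Sel_{p^∞}(E/F)^{Gal(F/F')}` for a tower `K ⊆ F' ⊆ F` (Dokchitser–Dokchitser 2010, Lemma 4.14, relative form)

Relative version of `Literature.NumberTheory.EllipticCurves.SelmerRestrictionCorank` (there the
base was `K` itself, `Sel_{p^∞}(E/K)` being the Selmer group of file `Selmer`). For an elliptic
curve `E = W` over a number field `K`, a prime `p`, and open normal subgroups `H ≤ H'` of `Γ_K`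
(`F = K̄^H ⊇ F' = K̄^{H'} ⊇ K`, `G = H'/H = Gal(F/F')`), both Selmer groups are taken in the tree's
subgroup model (`WeierstrassCurve.selmerGroupOver W p H`, file `SubgroupSelmer`), and
Dokchitser–Dokchitser's Lemma 4.14 for the Galois extension `F/F'` reads

* `zpCorank_selmerGroupOver_eq_relInvariants` —
  `corank_{ℤ_p} Sel_{p^∞}(E/F') = corank_{ℤ_p} Sel_{p^∞}(E/F)^{H'}`:
  the restriction `res : H¹(H', E[p^∞]) → H¹(H, E[p^∞])` carries `Sel_{p^∞}(E/F')` into the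
  `H'`-invariants of `Sel_{p^∞}(E/F)` with kernel killed by `[H' : H]` and cokernel killed by
  `[H' : H]²` ("kernel and cokernel killed by `|G|²`").

The proof is that of the absolute case, run inside the topological group `H'`: corestriction
along the open finite-index subgroup `H ∩ H'` of `H'` (the tree's `coresH1`,
`index_nsmul_eq_zero_of_resSubgroupH1_eq_zero`, `resSubgroupH1_coresH1` of
`PeriodIndexCorestriction`), transported along `H ∩ H' ≅ H` (`subgroupOfHom`, `toSubgroupOfH1`,
`ofSubgroupOfH1`: the cohomology of the copy `H.subgroupOf H'` of `H` inside `H'`); the local half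
at a place `v` of `K` is the same index argument inside the local group `H'_{K_v}` with its open
subgroup `H_{K_v}`, of index dividing `[H' : H]`. The finiteness inputs are the tree's
`finite_torsionBy_selmerGroupOver` (Silverman X.4.2(b) at every finite level). Everything here
is proved; no named fact is introduced. (This is the form of Lemma 4.14 used between consecutive
layers `M_n ⊂ M_{n+1}` of a `ℤ_p`-tower in Dokchitser–Dokchitser, §4.6: `rk_p(E/M) = m_1 + m_ε`,
i.e. `X_p(E/M) = X_p(E/F)^{Gal(F/M)}`.)

## References

* T. Dokchitser, V. Dokchitser, Ann. of Math. 172 (2010) = arXiv:math/0610290, Lemma 4.14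
  (arXiv: Lemma 47) and §4.6. [DokchitserDokchitserAnnals2010]
* R. Greenberg, LNM 1716 (1999), §2–3. [GreenbergLNM1716]
* J.-P. Serre, *Galois Cohomology* (1997), I.§2.4. [SerreGaloisCohomology1997]
-/

noncomputable section

open scoped Classical AddSubgroup

universe u

namespace Literature.NumberTheory.EllipticCurves

open GaloisRepresentations

/-! ## The copy `A.subgroupOf B` of `A ≤ B` inside `B`: transport of `H¹` -/

section SubgroupOf

variable {G : Type u} [Group G] [TopologicalSpace G] [IsTopologicalGroup G]
variable {A B : Subgroup G}
variable (M : Type u) [AddCommGroup M] [DistribMulAction G M] [TopologicalSpace M]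
  [DiscreteTopology M]

variable (A B) in
/-- The isomorphism `A.subgroupOf B → A` (as a continuous monoid homomorphism). [folklore] -/
def subgroupOfHom : A.subgroupOf B →ₜ* A where
  toFun x := ⟨x.1.1, Subgroup.mem_subgroupOf.mp x.2⟩
  map_one' := rfl
  map_mul' _ _ := rfl
  continuous_toFun := (continuous_subtype_val.comp continuous_subtype_val).subtype_mk _

omit [IsTopologicalGroup G] in
/-- Values of `subgroupOfHom`. [folklore] -/
@[simp]
theorem subgroupOfHom_apply_coe (x : A.subgroupOf B) :
    ((subgroupOfHom A B x : A) : G) = x.1.1 :=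
  rfl

/-- The inverse `A → A.subgroupOf B`. [folklore] -/
def subgroupOfInv (h : A ≤ B) : A →ₜ* A.subgroupOf B where
  toFun a := ⟨⟨a.1, h a.2⟩, Subgroup.mem_subgroupOf.mpr a.2⟩
  map_one' := rfl
  map_mul' _ _ := rfl
  continuous_toFun := (continuous_subtype_val.subtype_mk _).subtype_mk _

variable (A B) in
/-- Transport `H¹(A, M) → H¹(A.subgroupOf B, M)` along `A.subgroupOf B ≅ A`. [folklore] -/
def toSubgroupOfH1 : subgroupH1 A M →+ subgroupH1 (A.subgroupOf B) M :=
  resH1Hom (subgroupOfHom A B) (AddMonoidHom.id M) fun _ _ ↦ rfl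

/-- Transport back `H¹(A.subgroupOf B, M) → H¹(A, M)`. [folklore] -/
def ofSubgroupOfH1 (h : A ≤ B) : subgroupH1 (A.subgroupOf B) M →+ subgroupH1 A M :=
  resH1Hom (subgroupOfInv h) (AddMonoidHom.id M) fun _ _ ↦ rfl

/-- `ofSubgroupOfH1 ∘ toSubgroupOfH1 = id`. [folklore] -/
theorem ofSubgroupOfH1_toSubgroupOfH1 (h : A ≤ B) (y : subgroupH1 A M) :
    ofSubgroupOfH1 M h (toSubgroupOfH1 A B M y) = y := by
  rw [ofSubgroupOfH1, toSubgroupOfH1, ← AddMonoidHom.comp_apply, resH1Hom_comp]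
  have e : resH1Hom ((subgroupOfHom A B).comp (subgroupOfInv h))
      ((AddMonoidHom.id M).comp (AddMonoidHom.id M))
      (fun _ _ ↦ rfl) =
      resH1Hom (ContinuousMonoidHom.id _) (AddMonoidHom.id M) (fun _ _ ↦ rfl) :=
    resH1Hom_congr (by ext; rfl) (by ext; rfl) _ _
  rw [e, resH1Hom_id, AddMonoidHom.id_apply]

/-- **Restriction to `A.subgroupOf B` is restriction to `A`, transported**:
`res_{B → A ∩ B} = toSubgroupOfH1 ∘ res_{B → A}`. [folklore] -/
theorem resSubgroupH1_subgroupOf_eq (h : A ≤ B) (x : subgroupH1 B M) :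
    resSubgroupH1 (A.subgroupOf B) M x = toSubgroupOfH1 A B M (resOfLe M h x) := by
  rw [toSubgroupOfH1, resOfLe, resSubgroupH1, ← AddMonoidHom.comp_apply, resH1Hom_comp]
  exact DFunLike.congr_fun (resH1Hom_congr (by ext; rfl) (by ext; rfl) _ _) x

/-- `ofSubgroupOfH1 ∘ res_{B → A ∩ B} = res_{B → A}`. [folklore] -/
theorem ofSubgroupOfH1_resSubgroupH1 (h : A ≤ B) (x : subgroupH1 B M) :
    ofSubgroupOfH1 M h (resSubgroupH1 (A.subgroupOf B) M x) = resOfLe M h x := by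
  rw [resSubgroupH1_subgroupOf_eq M h, ofSubgroupOfH1_toSubgroupOfH1]

variable [A.Normal]

/-- `A.subgroupOf B` is normal in `B`. [folklore] -/
instance normal_subgroupOf_of_normal : (A.subgroupOf B).Normal :=
  Subgroup.Normal.subgroupOf inferInstance B

/-- **Conjugation is transported**: `g_* ∘ toSubgroupOfH1 = toSubgroupOfH1 ∘ g_*` for `g ∈ B`.
[folklore] -/
theorem conjH1_toSubgroupOfH1 (g : B) (y : subgroupH1 A M) :
    conjH1 (A.subgroupOf B) M g (toSubgroupOfH1 A B M y) = toSubgroupOfH1 A B M (conjH1 A M (g : G) y) := by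
  rw [toSubgroupOfH1, conjH1, conjH1, ← AddMonoidHom.comp_apply, ← AddMonoidHom.comp_apply,
    resH1Hom_comp, resH1Hom_comp]
  exact DFunLike.congr_fun (resH1Hom_congr (by ext; rfl) (by ext; rfl) _ _) y

variable [B.FiniteIndex]

omit [TopologicalSpace G] [IsTopologicalGroup G] [B.FiniteIndex] in
/-- `[B : A ∩ B] = relIndex`; it divides `relIndex A B'` for `B ≤ B'` (cosets inject). [folklore] -/
theorem relIndex_dvd_relIndex_of_le {B' : Subgroup G} (hBB' : B ≤ B') :
    A.relIndex B ∣ A.relIndex B' := by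
  haveI : (A.subgroupOf B').Normal := Subgroup.Normal.subgroupOf inferInstance B'
  rw [← Subgroup.relIndex_subgroupOf hBB']
  exact Subgroup.relIndex_dvd_index_of_normal _ _

end SubgroupOf

/-! ## Generic: invariant classes of `H¹(A, M)` under `B` are restrictions from `B`, up to `[B : A]` -/

section Relative

variable {G : Type u} [Group G] [TopologicalSpace G] [IsTopologicalGroup G]
variable {A B : Subgroup G} [A.Normal]
variable (M : Type u) [AddCommGroup M] [DistribMulAction G M] [TopologicalSpace M]
  [DiscreteTopology M]

omit [IsTopologicalGroup G] [A.Normal] in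
/-- `A.subgroupOf B` is open in `B` for `A` open. [folklore] -/
theorem isOpen_subgroupOf (hA : IsOpen (A : Set G)) : IsOpen (A.subgroupOf B : Set B) :=
  hA.preimage continuous_subtype_val

omit [A.Normal] in
/-- The kernel of `res : H¹(B, M) → H¹(A, M)` is killed by `[B : A]` (`cor ∘ res` inside `B`).
Serre, *Galois Cohomology*, I.§2.4. [cite: SerreGaloisCohomology1997, I.§2.4] -/
theorem relIndex_nsmul_eq_zero_of_resOfLe_eq_zero (h : A ≤ B) (hA : IsOpen (A : Set G))
    [(A.subgroupOf B).FiniteIndex] {x : subgroupH1 B M} (hx : resOfLe M h x = 0) :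
    A.relIndex B • x = 0 := by
  haveI : Fintype (B ⧸ A.subgroupOf B) := Fintype.ofFinite _
  have h0 : resSubgroupH1 (A.subgroupOf B) M x = 0 := by
    rw [resSubgroupH1_subgroupOf_eq M h, hx, map_zero]
  exact index_nsmul_eq_zero_of_resSubgroupH1_eq_zero (A.subgroupOf B) (isOpen_subgroupOf hA) h0

/-- **`[B : A] • H¹(A, M)^B ⊆ res H¹(B, M)`**: a class of `H¹(A, M)` fixed by every `g_*`, `g ∈ B`,
is, after multiplication by `[B : A]`, a restriction from `B` (`res ∘ cor` inside `B`,
transported along `A ∩ B ≅ A`). Dokchitser–Dokchitser 2010, proof of Lemma 4.14.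
[cite: DokchitserDokchitserAnnals2010, Lemma 4.14 (proof)] -/
theorem exists_resOfLe_eq_relIndex_nsmul (h : A ≤ B) (hA : IsOpen (A : Set G)) [(A.subgroupOf B).FiniteIndex]
    {y : subgroupH1 A M} (hy : ∀ g : B, conjH1 A M (g : G) y = y) :
    ∃ x : subgroupH1 B M, resOfLe M h x = A.relIndex B • y := by
  have hinv : ∀ g : B, conjH1 (A.subgroupOf B) M g (toSubgroupOfH1 A B M y) = toSubgroupOfH1 A B M y :=
    fun g ↦ by rw [conjH1_toSubgroupOfH1, hy]
  obtain ⟨x, hx⟩ := exists_resSubgroupH1_eq_index_nsmul_of_forall_conjH1_eq (A.subgroupOf B)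
    (isOpen_subgroupOf hA) hinv
  refine ⟨x, ?_⟩
  rw [← ofSubgroupOfH1_resSubgroupH1 M h, hx, map_nsmul, ofSubgroupOfH1_toSubgroupOfH1]
  rfl

end Relative

end Literature.NumberTheory.EllipticCurves

/-! ## The Selmer groups over `F' ⊆ F` -/

namespace WeierstrassCurve

open Literature.NumberTheory.EllipticCurves Literature.NumberTheory.GaloisRepresentations

variable {K : Type} [Field K] [NumberField K] (W : WeierstrassCurve K) (p : ℕ)
variable {H H' : Subgroup (Field.absoluteGaloisGroup K)} [H.Normal] [H'.Normal]

section Local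

variable {E : Type} [Field E] [Algebra K E]

omit [NumberField K] [H'.Normal] in
/-- **One place, relative.** If `res_{H'→H} η` dies in `H¹(H_E, E(K̄_E))` then `[H' : H] • η`
dies in `H¹(H'_E, E(K̄_E))`: the local class of `η` on `H'_E` dies on the open subgroup
`H_E ≤ H'_E` of index dividing `[H' : H]` (`localResOverOfEmb_resOfLe`), hence is killed by that
index (`cor ∘ res` inside `H'_E`). Dokchitser–Dokchitser 2010, proof of Lemma 4.14.
[cite: DokchitserDokchitserAnnals2010, Lemma 4.14 (proof)] -/
theorem relIndex_nsmul_mem_localKerOver_of_resOfLe_mem (h : H ≤ H')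
    (hH : IsOpen (H : Set (Field.absoluteGaloisGroup K)))
    [(H.subgroupOf H').FiniteIndex] {η : W.subgroupH1 p H'}
    (hη : W.resOfLe p h η ∈ W.localKerOver p H E) :
    H.relIndex H' • η ∈ W.localKerOver p H' E := by
  set ι := closureEmb (K := K) E with hι
  rw [localKerOver_eq_ofEmb, localKerOverOfEmb, AddMonoidHom.mem_ker] at hη ⊢
  rw [W.localResOverOfEmb_resOfLe p ι h] at hη
  -- `ξ`, the local class of `η` on `H'_E`, dies on `H_E`
  set ξ := W.localResOverOfEmb p H' ι η with hξ
  have hle : localSubgroupOfEmb H ι ≤ localSubgroupOfEmb H' ι := Subgroup.comap_mono h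
  haveI : (localSubgroupOfEmb H ι).Normal := Subgroup.normal_comap _
  -- finiteness of the index of `H_E` in `H'_E`: it divides `[H' : H]`
  have hdvd : (localSubgroupOfEmb H ι).relIndex (localSubgroupOfEmb H' ι) ∣ H.relIndex H' := by
    rw [localSubgroupOfEmb, localSubgroupOfEmb, Subgroup.relIndex_comap]
    exact relIndex_dvd_relIndex_of_le (Subgroup.map_comap_le _ _)
  haveI : ((localSubgroupOfEmb H ι).subgroupOf (localSubgroupOfEmb H' ι)).FiniteIndex :=
    ⟨fun h0 ↦ Subgroup.FiniteIndex.index_ne_zero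
      (Nat.eq_zero_of_zero_dvd ((show (localSubgroupOfEmb H ι).relIndex (localSubgroupOfEmb H' ι) = 0
        from h0) ▸ hdvd))⟩
  have hkill := relIndex_nsmul_eq_zero_of_resOfLe_eq_zero (localPoints W E) hle
    (isOpen_localSubgroupOfEmb H ι hH) hη
  obtain ⟨d, hd⟩ := hdvd
  rw [map_nsmul, ← hξ, hd, mul_nsmul, hkill, nsmul_zero]

end Local

/-- **The local half, relative: `res_{H'→H} η ∈ Sel_{p^∞}(E/F) ⇒ [H' : H] • η ∈ Sel_{p^∞}(E/F')`.**
[cite: DokchitserDokchitserAnnals2010, Lemma 4.14 (proof)] -/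
theorem relIndex_nsmul_mem_selmerGroupOver_of_resOfLe_mem (h : H ≤ H')
    (hH : IsOpen (H : Set (Field.absoluteGaloisGroup K))) [(H.subgroupOf H').FiniteIndex]
    {η : W.subgroupH1 p H'} (hη : W.resOfLe p h η ∈ W.selmerGroupOver p H) :
    H.relIndex H' • η ∈ W.selmerGroupOver p H' := by
  rw [mem_selmerGroupOver_iff] at hη ⊢
  have hcomm : ∀ σ, W.conjH1 p H σ (W.resOfLe p h η) = W.resOfLe p h (W.conjH1 p H' σ η) :=
    fun σ ↦ (congrArg (fun f ↦ f η)
      (resOfLe_comp_conjH1_holds (M := geomPrimaryTorsion W p) h σ)).symm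
  refine ⟨fun v σ ↦ ?_, fun w σ ↦ ?_⟩
  · have h1 := hη.1 v σ
    rw [hcomm] at h1
    rw [map_nsmul]
    exact W.relIndex_nsmul_mem_localKerOver_of_resOfLe_mem p h hH h1
  · have h1 := hη.2 w σ
    rw [hcomm] at h1
    rw [map_nsmul]
    exact W.relIndex_nsmul_mem_localKerOver_of_resOfLe_mem p h hH h1

variable (H H') in
/-- **`Sel_{p^∞}(E/F)^{Gal(F/F')}`** in the subgroup model: the classes of `Sel_{p^∞}(E/K̄^H)` fixed by
the conjugation action of every `g ∈ H'`. [cite: DokchitserDokchitserAnnals2010, Lemma 4.14] -/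
def selmerGroupOverRelInvariants : AddSubgroup (W.subgroupH1 p H) :=
  W.selmerGroupOver p H ⊓ ⨅ g : H', (W.conjH1 p H (g : Field.absoluteGaloisGroup K) - AddMonoidHom.id _).ker

omit [H'.Normal] in
/-- Membership in `Sel_{p^∞}(E/F)^{Gal(F/F')}`. [cite: DokchitserDokchitserAnnals2010, Lemma 4.14] -/
theorem mem_selmerGroupOverRelInvariants_iff (y : W.subgroupH1 p H) :
    y ∈ W.selmerGroupOverRelInvariants p H H' ↔
      y ∈ W.selmerGroupOver p H ∧ ∀ g : H', W.conjH1 p H (g : Field.absoluteGaloisGroup K) y = y := by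
  simp only [selmerGroupOverRelInvariants, AddSubgroup.mem_inf, AddSubgroup.mem_iInf,
    AddMonoidHom.mem_ker, AddMonoidHom.sub_apply, AddMonoidHom.id_apply, sub_eq_zero]

/-- **The restriction `Sel_{p^∞}(E/F') → Sel_{p^∞}(E/F)^{Gal(F/F')}`.**
[cite: DokchitserDokchitserAnnals2010, Lemma 4.14 (proof)] -/
def selmerRelRestriction (h : H ≤ H') :
    W.selmerGroupOver p H' →+ W.selmerGroupOverRelInvariants p H H' :=
  ((W.resOfLe p h).comp (W.selmerGroupOver p H').subtype).codRestrict
    (W.selmerGroupOverRelInvariants p H H') fun η ↦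
      (W.mem_selmerGroupOverRelInvariants_iff p _).mpr
        ⟨W.resOfLe_mem_selmerGroupOver p h η.2,
          fun g ↦ conjH1_resOfLe_of_mem (geomPrimaryTorsion W p) h g.2 _⟩

/-- Values of `selmerRelRestriction`. [folklore] -/
@[simp]
theorem coe_selmerRelRestriction (h : H ≤ H') (η : W.selmerGroupOver p H') :
    ((W.selmerRelRestriction p h η : W.selmerGroupOverRelInvariants p H H') : W.subgroupH1 p H) =
      W.resOfLe p h η :=
  rfl

variable [Fact p.Prime] [W.IsElliptic]

/-- **Dokchitser–Dokchitser 2010, Lemma 4.14, relative form** (subgroup model, `ℤ_p`-coranks):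
for an elliptic curve `E = W` over a number field `K`, a prime `p`, and open normal subgroups
`H ≤ H'` of `Γ_K` (`F = K̄^H ⊇ F' = K̄^{H'}`, `G = Gal(F/F') = H'/H`),
`corank_{ℤ_p} Sel_{p^∞}(E/F') = corank_{ℤ_p} Sel_{p^∞}(E/F)^G`: the restriction has kernel killed
by `|G|` and cokernel killed by `|G|²`, and both `p`-torsion subgroups are finite
(`finite_torsionBy_selmerGroupOver`). [cite: DokchitserDokchitserAnnals2010, Lemma 4.14] -/
theorem zpCorank_selmerGroupOver_eq_relInvariants (h : H ≤ H')
    (hH : IsOpen (H : Set (Field.absoluteGaloisGroup K)))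
    (hH' : IsOpen (H' : Set (Field.absoluteGaloisGroup K))) [(H.subgroupOf H').FiniteIndex] :
    zpCorank (W.selmerGroupOver p H') p = zpCorank (W.selmerGroupOverRelInvariants p H H') p := by
  haveI : Finite (W.selmerGroupOver p H')[(p : ℤ)] := finite_torsionBy_selmerGroupOver W p H' hH'
  haveI : Finite (W.selmerGroupOver p H)[(p : ℤ)] := finite_torsionBy_selmerGroupOver W p H hH
  haveI : CompactSpace (Field.absoluteGaloisGroup K) := compactSpace_absoluteGaloisGroup K
  have hM : ∀ m : geomPrimaryTorsion W p, ∃ k : ℕ, p ^ k • m = 0 := fun m ↦ by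
    obtain ⟨k, hk⟩ := AddCommGroup.mem_primaryComponent.mp m.2
    exact ⟨k, Subtype.ext (by rw [AddSubmonoidClass.coe_nsmul, hk, ZeroMemClass.coe_zero])⟩
  have hA : ∀ a : W.selmerGroupOver p H', ∃ n : ℕ, p ^ n • a = 0 := fun a ↦ by
    obtain ⟨n, hn⟩ := exists_pow_nsmul_eq_zero_subgroupH1 H' (Subgroup.isClosed_of_isOpen H' hH')
      hM (a : W.subgroupH1 p H')
    exact ⟨n, Subtype.ext (by rw [AddSubmonoidClass.coe_nsmul, hn, ZeroMemClass.coe_zero])⟩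
  have hle : W.selmerGroupOverRelInvariants p H H' ≤ W.selmerGroupOver p H := fun y hy ↦
    ((W.mem_selmerGroupOverRelInvariants_iff p y).mp hy).1
  have hB : ∀ b : W.selmerGroupOverRelInvariants p H H', ∃ n : ℕ, p ^ n • b = 0 := fun b ↦ by
    obtain ⟨n, hn⟩ := exists_pow_nsmul_eq_zero_subgroupH1 H (Subgroup.isClosed_of_isOpen H hH)
      hM (b : W.subgroupH1 p H)
    exact ⟨n, Subtype.ext (by rw [AddSubmonoidClass.coe_nsmul, hn, ZeroMemClass.coe_zero])⟩
  have hmemT : ∀ x : (W.selmerGroupOverRelInvariants p H H')[(p : ℤ)],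
      (⟨_, hle (x : W.selmerGroupOverRelInvariants p H H').2⟩ : W.selmerGroupOver p H) ∈
        (W.selmerGroupOver p H)[(p : ℤ)] := fun x ↦ by
    have hx := congrArg Subtype.val (AddSubgroup.torsionBy.nsmul_iff.mp x.2)
    rw [AddSubgroup.torsionBy.nsmul_iff]
    apply Subtype.ext
    simpa using hx
  haveI : Finite (W.selmerGroupOverRelInvariants p H H')[(p : ℤ)] :=
    Finite.of_injective (fun x : (W.selmerGroupOverRelInvariants p H H')[(p : ℤ)] ↦
      (⟨_, hmemT x⟩ : (W.selmerGroupOver p H)[(p : ℤ)])) fun x y hxy ↦ by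
        have h1 := congrArg (fun z : (W.selmerGroupOver p H)[(p : ℤ)] ↦
          ((z : W.selmerGroupOver p H) : W.subgroupH1 p H)) hxy
        exact Subtype.ext (Subtype.ext h1)
  have hidx : H.relIndex H' ≠ 0 := Subgroup.FiniteIndex.index_ne_zero
  refine zpCorank_eq_of_nsmul_ker_of_nsmul_coker (W.selmerRelRestriction p h) hA hB
    (N := H.relIndex H' * H.relIndex H') (mul_ne_zero hidx hidx) (fun a ha ↦ ?_) (fun b ↦ ?_)
  · -- kernel
    have h0 : W.resOfLe p h (a : W.subgroupH1 p H') = 0 := by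
      rw [← coe_selmerRelRestriction, ha]; rfl
    have h1 := relIndex_nsmul_eq_zero_of_resOfLe_eq_zero (geomPrimaryTorsion W p) h hH h0
    apply Subtype.ext
    rw [AddSubmonoidClass.coe_nsmul, mul_nsmul, h1, nsmul_zero, ZeroMemClass.coe_zero]
  · -- cokernel
    obtain ⟨hbT, hbinv⟩ := (W.mem_selmerGroupOverRelInvariants_iff p _).mp b.2
    obtain ⟨x, hx⟩ := exists_resOfLe_eq_relIndex_nsmul (geomPrimaryTorsion W p) h hH hbinv
    have hxT : W.resOfLe p h x ∈ W.selmerGroupOver p H := by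
      change Literature.NumberTheory.EllipticCurves.resOfLe (geomPrimaryTorsion W p) h x ∈ _
      rw [hx]; exact AddSubgroup.nsmul_mem _ hbT _
    have hxS := W.relIndex_nsmul_mem_selmerGroupOver_of_resOfLe_mem p h hH hxT
    refine ⟨⟨H.relIndex H' • x, hxS⟩, Subtype.ext ?_⟩
    rw [coe_selmerRelRestriction, AddSubmonoidClass.coe_nsmul]
    change W.resOfLe p h (H.relIndex H' • x) = _
    rw [map_nsmul]
    change H.relIndex H' • Literature.NumberTheory.EllipticCurves.resOfLe (geomPrimaryTorsion W p) h x = _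
    rw [hx, ← mul_nsmul]

end WeierstrassCurve
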